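import Mathlib
import Summits.Ventures.HodgeRepro.Tier4.Target
import Summits.Ventures.HodgeRepro.Tier4.Common.TargetBall
import Summits.Ventures.HodgeRepro.Tier4.Common.TargetCalculus
import Summits.Ventures.HodgeRepro.Tier4.Common.AutForms
import Summits.Ventures.HodgeRepro.Tier4.Line4.HoloRegularity
import Summits.Ventures.HodgeRepro.Tier4.Line3.BallChangeOfVariables
import Summits.Ventures.HodgeRepro.Tier4.Line3.DomainTransfer

/-!
# Tier4/Line4/Partition — a smooth partition function for the tiling of the ball by a level `Γ′`
(SUPPORT (S4) for L4.0′ `pair11_descends`, V2)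

Blind re-derivation cell `pub-hodge-repro`, Tier 4 (README §9–§10), seat t4-L4-p2 (prover, LINE L4, gen 0).  Tree path
`lean/Summits/Ventures/HodgeRepro/Tier4/Line4/Partition.lean`.  Imports, BY NAME, typer-2's `Common/TargetBall`
(`actM_mul`, `mulVec_lift3_apply`, `toBallMat_mul`), t4-L3-p1's `Line3/BallChangeOfVariables` (`isUnit_of_unitaryJ`,
`actM_inv_actM`, `inv_unitaryJ`) and `Line3/DomainTransfer` (`exists_unitaryJ_of_mem_ballActions`,
`exists_inv_ballActions`, `toBallMat_unitaryJ`).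

WHAT IS PROVED.  §1 `actM_eq_of_eqOn_ball`: two `U(2,1)`-Möbius maps that agree on the ball agree on all of `ℂ²`
(identity principle for the polynomial `num_M · den_N − num_N · den_M`; junk values are forced equal) — so the set
`ballActions τ₀ C Γ′` of MAPS is a group under composition on the ball: `exists_comp_mem_ballActions`, and the
right translation `rtrans φ′ : ballActions ≃ ballActions` (`rtrans_apply`: `(rtrans φ′ φ) z = φ (φ′ z)` on the ball).
§2 the partition function: from the cocompactness (K) and proper discontinuity (P) of the ball action (LitCompactness,
consumed as hypotheses in exactly their shape), a function `χ : ℂ² → ℝ` with `ContDiffOn ℝ 1 χ ball`, `0 ≤ χ`,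
vanishing off a compact subset of the ball, LOCALLY FINITE (`∀ z ∈ ball, ∃ U ∈ 𝓝 z, {φ | ∃ w ∈ U, χ (φ w) ≠ 0}.Finite`)
and with `Σ_φ χ (φ z) = 1` on the ball (`HasSum`) — `exists_partition`.  Construction: a smooth bump `χ₀` with support
the open set `{nsq < r}` (Mathlib `IsOpen.exists_contDiff_support_eq`), `r < 1` chosen so that `K ⊆ {nsq < r}`;
`S z := Σ_φ χ₀ (φ z)` (locally a finite sum by (P), `≥ χ₀ (φ₀ z) > 0` by (K), invariant under the action by the
right-translation bijection); `χ := χ₀ / S`.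

Nothing here says anything about the status of the Hodge conjecture for CM abelian varieties, which is NOT proved
(HC_CM is NOT proved by anyone in this repository).
-/

set_option autoImplicit false

noncomputable section

open Matrix MeasureTheory NumberField Topology Set
open scoped ComplexConjugate

namespace Summit.Ventures.HodgeRepro.Tier4.Line4

open Summit.Ventures.HodgeRepro.Tier4 Summit.Ventures.HodgeRepro.Tier4.Line3

/-! ## 1. `U(2,1)`-Möbius maps are determined by their values on the ball; the group structure of `ballActions` -/

section Moebius

variable {M N : Matrix (Fin 3) (Fin 3) ℂ}

/-- The coordinates of `M (z, 1)` are polynomial (analytic) in `z`. -/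
theorem analyticOnNhd_mulVec_lift3 (M : Matrix (Fin 3) (Fin 3) ℂ) (i : Fin 3) :
    AnalyticOnNhd ℂ (fun z : Fin 2 → ℂ => (M *ᵥ lift3 z) i) univ := by
  have h : (fun z : Fin 2 → ℂ => (M *ᵥ lift3 z) i) = fun z => M i 0 * z 0 + M i 1 * z 1 + M i 2 := by
    funext z; exact mulVec_lift3_apply M z i
  rw [h]
  have h0 : AnalyticOnNhd ℂ (fun z : Fin 2 → ℂ => z 0) univ :=
    (ContinuousLinearMap.proj (R := ℂ) (φ := fun _ : Fin 2 => ℂ) 0).analyticOnNhd univ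
  have h1 : AnalyticOnNhd ℂ (fun z : Fin 2 → ℂ => z 1) univ :=
    (ContinuousLinearMap.proj (R := ℂ) (φ := fun _ : Fin 2 => ℂ) 1).analyticOnNhd univ
  exact ((analyticOnNhd_const.mul h0).add (analyticOnNhd_const.mul h1)).add analyticOnNhd_const

/-- `M (z, 1) ≠ 0` for an invertible `M`. -/
theorem mulVec_lift3_ne_zero (hM : IsUnit M) (z : Fin 2 → ℂ) : M *ᵥ lift3 z ≠ 0 := by
  intro h
  have h1 : M⁻¹ *ᵥ (M *ᵥ lift3 z) = lift3 z := by
    rw [Matrix.mulVec_mulVec, Matrix.nonsing_inv_mul M ((Matrix.isUnit_iff_isUnit_det M).mp hM), Matrix.one_mulVec]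
  rw [h, Matrix.mulVec_zero] at h1
  have h2 := congrFun h1 2
  simp [lift3] at h2

/-- **Two `U(2,1)`-Möbius maps that agree on the ball agree everywhere** (as functions on `ℂ²`, junk included). -/
theorem actM_eq_of_eqOn_ball (hM : Mᴴ * J * M = J) (hN : Nᴴ * J * N = J)
    (h : ∀ z ∈ ball, actM M z = actM N z) : actM M = actM N := by
  -- the polynomial identities `num_M i · den_N = num_N i · den_M`, first on the ball, then everywhere
  have hP : ∀ i : Fin 2, ∀ z : Fin 2 → ℂ,
      (M *ᵥ lift3 z) (Fin.castSucc i) * (N *ᵥ lift3 z) 2 = (N *ᵥ lift3 z) (Fin.castSucc i) * (M *ᵥ lift3 z) 2 := by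
    intro i
    have hA : AnalyticOnNhd ℂ (fun z : Fin 2 → ℂ => (M *ᵥ lift3 z) (Fin.castSucc i) * (N *ᵥ lift3 z) 2
        - (N *ᵥ lift3 z) (Fin.castSucc i) * (M *ᵥ lift3 z) 2) univ :=
      ((analyticOnNhd_mulVec_lift3 M _).mul (analyticOnNhd_mulVec_lift3 N _)).sub
        ((analyticOnNhd_mulVec_lift3 N _).mul (analyticOnNhd_mulVec_lift3 M _))
    have h0 : (fun z : Fin 2 → ℂ => (M *ᵥ lift3 z) (Fin.castSucc i) * (N *ᵥ lift3 z) 2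
        - (N *ᵥ lift3 z) (Fin.castSucc i) * (M *ᵥ lift3 z) 2) =ᶠ[𝓝 (0 : Fin 2 → ℂ)] 0 := by
      have h0b : (0 : Fin 2 → ℂ) ∈ ball := by simp [ball, nsq]
      filter_upwards [isOpen_ball.mem_nhds h0b] with z hz
      have hMz := mulVec_lift3_two_ne_zero hM hz
      have hNz := mulVec_lift3_two_ne_zero hN hz
      have := congrFun (h z hz) i
      simp only [actM] at this
      rw [div_eq_div_iff hMz hNz] at this
      simp only [Pi.zero_apply]
      linear_combination this
    have := hA.eqOn_zero_of_preconnected_of_eventuallyEq_zero isPreconnected_univ (mem_univ _) h0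
    intro z
    have hz := this (mem_univ z)
    simp only [Pi.zero_apply] at hz
    linear_combination hz
  funext z i
  simp only [actM]
  by_cases hMz : (M *ᵥ lift3 z) 2 = 0
  · by_cases hNz : (N *ᵥ lift3 z) 2 = 0
    · rw [hMz, hNz, div_zero, div_zero]
    · exfalso
      apply mulVec_lift3_ne_zero (isUnit_of_unitaryJ hM) z
      funext j
      have hj : ∀ i : Fin 2, (M *ᵥ lift3 z) (Fin.castSucc i) = 0 := fun i => by
        have := hP i z
        rw [hMz, mul_zero] at this
        exact (mul_eq_zero.mp this).resolve_right hNz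
      fin_cases j
      · exact hj 0
      · exact hj 1
      · exact hMz
  · by_cases hNz : (N *ᵥ lift3 z) 2 = 0
    · exfalso
      apply mulVec_lift3_ne_zero (isUnit_of_unitaryJ hN) z
      funext j
      have hj : ∀ i : Fin 2, (N *ᵥ lift3 z) (Fin.castSucc i) = 0 := fun i => by
        have := hP i z
        rw [hNz, mul_zero] at this
        exact (mul_eq_zero.mp this.symm).resolve_right hMz
      fin_cases j
      · exact hj 0
      · exact hj 1
      · exact hNz
    · rw [div_eq_div_iff hMz hNz]
      exact hP i z

end Moebius

section Group

variable {E : Type*} [Field E] {c : E ≃+* E} {H : Matrix (Fin 3) (Fin 3) E} {τ₀ : E →+* ℂ}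
  {C : Matrix (Fin 3) (Fin 3) ℂ} {Γ' : Set (Matrix (Fin 3) (Fin 3) E)}

/-- Every map of `ballActions` maps the ball into the ball. -/
theorem mem_ball_of_mem_ballActions (hΓ : IsCongruenceSubgroup c H Γ') (hτ : ∀ x, τ₀ (c x) = conj (τ₀ x))
    (hC : IsSylvester (H.map τ₀) C) {φ : (Fin 2 → ℂ) → (Fin 2 → ℂ)} (hφ : φ ∈ ballActions τ₀ C Γ') {z : Fin 2 → ℂ}
    (hz : z ∈ ball) : φ z ∈ ball := by
  obtain ⟨M, hM, rfl⟩ := exists_unitaryJ_of_mem_ballActions hΓ hτ hC hφ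
  exact actM_mem_ball hM hz

/-- Two maps of `ballActions` that agree on the ball are equal. -/
theorem eq_of_eqOn_ball_of_mem_ballActions (hΓ : IsCongruenceSubgroup c H Γ') (hτ : ∀ x, τ₀ (c x) = conj (τ₀ x))
    (hC : IsSylvester (H.map τ₀) C) {φ ψ : (Fin 2 → ℂ) → (Fin 2 → ℂ)} (hφ : φ ∈ ballActions τ₀ C Γ')
    (hψ : ψ ∈ ballActions τ₀ C Γ') (h : ∀ z ∈ ball, φ z = ψ z) : φ = ψ := by
  obtain ⟨M, hM, rfl⟩ := exists_unitaryJ_of_mem_ballActions hΓ hτ hC hφ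
  obtain ⟨N, hN, rfl⟩ := exists_unitaryJ_of_mem_ballActions hΓ hτ hC hψ
  exact actM_eq_of_eqOn_ball hM hN h

/-- Composition on the ball stays in `ballActions`. -/
theorem exists_comp_mem_ballActions (hΓ : IsCongruenceSubgroup c H Γ') (hτ : ∀ x, τ₀ (c x) = conj (τ₀ x))
    (hC : IsSylvester (H.map τ₀) C) {φ ψ : (Fin 2 → ℂ) → (Fin 2 → ℂ)} (hφ : φ ∈ ballActions τ₀ C Γ')
    (hψ : ψ ∈ ballActions τ₀ C Γ') : ∃ θ ∈ ballActions τ₀ C Γ', ∀ z ∈ ball, θ z = φ (ψ z) := by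
  obtain ⟨γ, hγ, rfl⟩ := hφ
  obtain ⟨δ, hδ, rfl⟩ := hψ
  refine ⟨actM (toBallMat τ₀ C (γ * δ)), ⟨γ * δ, hΓ.2.1 γ hγ δ hδ, rfl⟩, fun z hz => ?_⟩
  rw [toBallMat_mul τ₀ hC.1, actM_mul (toBallMat_unitaryJ hΓ hτ hC hδ) hz]

/-- Every map of `ballActions` is onto the ball: `φ (ψ w) = w` for the inverse `ψ` and `w ∈ ball`. -/
theorem exists_right_inv_ballActions (hΓ : IsCongruenceSubgroup c H Γ') (hτ : ∀ x, τ₀ (c x) = conj (τ₀ x))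
    (hC : IsSylvester (H.map τ₀) C) {φ : (Fin 2 → ℂ) → (Fin 2 → ℂ)} (hφ : φ ∈ ballActions τ₀ C Γ') :
    ∃ ψ ∈ ballActions τ₀ C Γ', (∀ z ∈ ball, ψ (φ z) = z) ∧ ∀ w ∈ ball, φ (ψ w) = w := by
  obtain ⟨ψ, hψ, hinv⟩ := exists_inv_ballActions hΓ hτ hC hφ
  refine ⟨ψ, hψ, hinv, fun w hw => ?_⟩
  obtain ⟨N, hN, rfl⟩ := exists_unitaryJ_of_mem_ballActions hΓ hτ hC hψ
  have h1 : actM N (φ (actM N w)) = actM N w :=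
    hinv (actM N w) (actM_mem_ball hN hw)
  exact actM_injOn_ball hN (mem_ball_of_mem_ballActions hΓ hτ hC hφ (actM_mem_ball hN hw)) hw h1

/-- **Right translation by `φ′` is a bijection of `ballActions`**: an equivalence `e` with
`(e φ) z = φ (φ′ z)` on the ball. -/
theorem exists_rtrans_equiv (hΓ : IsCongruenceSubgroup c H Γ') (hτ : ∀ x, τ₀ (c x) = conj (τ₀ x))
    (hC : IsSylvester (H.map τ₀) C) (φ' : ballActions τ₀ C Γ') :
    ∃ e : ballActions τ₀ C Γ' ≃ ballActions τ₀ C Γ', ∀ φ : ballActions τ₀ C Γ', ∀ z ∈ ball,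
      (e φ).1 z = φ.1 (φ'.1 z) := by
  classical
  have hex : ∀ φ : ballActions τ₀ C Γ', ∃ θ : ballActions τ₀ C Γ', ∀ z ∈ ball, θ.1 z = φ.1 (φ'.1 z) := by
    intro φ
    obtain ⟨θ, hθ, h⟩ := exists_comp_mem_ballActions hΓ hτ hC φ.2 φ'.2
    exact ⟨⟨θ, hθ⟩, h⟩
  choose f hf using hex
  obtain ⟨ψ, hψ, hψl, hψr⟩ := exists_right_inv_ballActions hΓ hτ hC φ'.2
  have hinj : Function.Injective f := by
    intro φ₁ φ₂ h
    apply Subtype.ext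
    refine eq_of_eqOn_ball_of_mem_ballActions hΓ hτ hC φ₁.2 φ₂.2 fun w hw => ?_
    have hw' : ψ w ∈ ball := mem_ball_of_mem_ballActions hΓ hτ hC hψ hw
    have h1 := hf φ₁ (ψ w) hw'
    have h2 := hf φ₂ (ψ w) hw'
    rw [hψr w hw] at h1 h2
    rw [← h1, ← h2, h]
  have hsurj : Function.Surjective f := by
    intro θ
    obtain ⟨φ, hφ, hφeq⟩ := exists_comp_mem_ballActions hΓ hτ hC θ.2 hψ
    refine ⟨⟨φ, hφ⟩, Subtype.ext ?_⟩
    refine eq_of_eqOn_ball_of_mem_ballActions hΓ hτ hC (f ⟨φ, hφ⟩).2 θ.2 fun z hz => ?_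
    rw [hf ⟨φ, hφ⟩ z hz]
    show φ (φ'.1 z) = θ.1 z
    rw [hφeq _ (mem_ball_of_mem_ballActions hΓ hτ hC φ'.2 hz), hψl z hz]
  exact ⟨Equiv.ofBijective f ⟨hinj, hsurj⟩, fun φ z hz => hf φ z hz⟩

end Group

/-! ## 2. The partition function -/

section Bump

/-- The sublevel set `{nsq < r}` is open. -/
theorem isOpen_nsq_lt (r : ℝ) : IsOpen {z : Fin 2 → ℂ | nsq z < r} := isOpen_lt continuous_nsq continuous_const

/-- The sublevel set `{nsq ≤ r}` is compact. -/
theorem isCompact_nsq_le (r : ℝ) : IsCompact {z : Fin 2 → ℂ | nsq z ≤ r} := by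
  refine Metric.isCompact_of_isClosed_isBounded (isClosed_le continuous_nsq continuous_const) ?_
  refine (Metric.isBounded_closedBall (x := (0 : Fin 2 → ℂ)) (r := Real.sqrt (max r 0))).subset fun z hz => ?_
  rw [Metric.mem_closedBall, dist_zero_right, pi_norm_le_iff_of_nonneg (Real.sqrt_nonneg _)]
  have hz' : nsq z ≤ r := hz
  have h0 : ‖z 0‖ ^ 2 + ‖z 1‖ ^ 2 ≤ r := hz'
  rw [Fin.forall_fin_two]
  constructor
  · rw [Real.le_sqrt (norm_nonneg _) (le_max_right _ _)]
    nlinarith [sq_nonneg ‖z 1‖, le_max_left r 0]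
  · rw [Real.le_sqrt (norm_nonneg _) (le_max_right _ _)]
    nlinarith [sq_nonneg ‖z 0‖, le_max_left r 0]

/-- `{nsq ≤ r} ⊆ ball` for `r < 1`. -/
theorem nsq_le_subset_ball {r : ℝ} (hr : r < 1) : {z : Fin 2 → ℂ | nsq z ≤ r} ⊆ ball :=
  fun z hz => lt_of_le_of_lt (show nsq z ≤ r from hz) hr

/-- A compact subset of the ball lies in some `{nsq < r}`, `r < 1`. -/
theorem exists_nsq_lt_of_isCompact {K : Set (Fin 2 → ℂ)} (hK : IsCompact K) (hKb : K ⊆ ball) :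
    ∃ r : ℝ, r < 1 ∧ ∀ z ∈ K, nsq z < r := by
  rcases K.eq_empty_or_nonempty with h | hne
  · exact ⟨0, by norm_num, fun z hz => by simp [h] at hz⟩
  · obtain ⟨z₀, hz₀, hmax⟩ := hK.exists_isMaxOn hne continuous_nsq.continuousOn
    have h1 : nsq z₀ < 1 := hKb hz₀
    refine ⟨(nsq z₀ + 1) / 2, by linarith, fun z hz => ?_⟩
    have := hmax hz
    simp only [Set.mem_setOf_eq] at this
    linarith

/-- A `C¹` bump `χ₀ ≥ 0` on `ℂ²` with support exactly `{nsq < r}`. -/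
theorem exists_bump (r : ℝ) : ∃ χ₀ : (Fin 2 → ℂ) → ℝ, ContDiff ℝ 1 χ₀ ∧ (∀ z, 0 ≤ χ₀ z) ∧
    (∀ z, χ₀ z ≠ 0 ↔ nsq z < r) := by
  obtain ⟨f, hsupp, hf, hrange⟩ := (isOpen_nsq_lt r).exists_contDiff_support_eq (n := 1)
  refine ⟨f, hf, fun z => (hrange ⟨z, rfl⟩).1, fun z => ?_⟩
  rw [← Function.mem_support, hsupp]
  rfl

end Bump

section Partition

variable {E : Type*} [Field E] {c : E ≃+* E} {H : Matrix (Fin 3) (Fin 3) E} {τ₀ : E →+* ℂ}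
  {C : Matrix (Fin 3) (Fin 3) ℂ} {Γ' : Set (Matrix (Fin 3) (Fin 3) E)}

/-- Every map of `ballActions` is real-`C¹` on the ball (it is holomorphic there). -/
theorem contDiffOn_of_mem_ballActions (hΓ : IsCongruenceSubgroup c H Γ') (hτ : ∀ x, τ₀ (c x) = conj (τ₀ x))
    (hC : IsSylvester (H.map τ₀) C) {φ : (Fin 2 → ℂ) → (Fin 2 → ℂ)} (hφ : φ ∈ ballActions τ₀ C Γ') :
    ContDiffOn ℝ 1 φ ball := by
  obtain ⟨M, hM, rfl⟩ := exists_unitaryJ_of_mem_ballActions hΓ hτ hC hφ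
  have hd : DifferentiableOn ℂ (actM M) ball := differentiableOn_actM hM
  have h1 : ContDiffOn ℂ 1 (actM M) ball := by
    rw [contDiffOn_pi]
    intro i
    have := HoloReg.contDiffOn_of_differentiableOn isOpen_ball 1 _ ((differentiableOn_pi.mp hd) i)
    simpa using this
  exact h1.restrict_scalars ℝ

/-- A real function continuous on an open `U` and vanishing off a closed `K ⊆ U` is continuous. -/
theorem continuous_of_continuousOn_of_eqOn_zero_real {U K : Set (Fin 2 → ℂ)} (hU : IsOpen U) (hK : IsClosed K)
    (hKU : K ⊆ U) {f : (Fin 2 → ℂ) → ℝ} (hf : ContinuousOn f U) (h0 : ∀ z ∉ K, f z = 0) : Continuous f := by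
  rw [continuous_iff_continuousAt]
  intro z
  by_cases hz : z ∈ U
  · exact hf.continuousAt (hU.mem_nhds hz)
  · have hzK : z ∉ K := fun h => hz (hKU h)
    have h : (fun _ => (0 : ℝ)) =ᶠ[𝓝 z] f := by
      filter_upwards [hK.isOpen_compl.mem_nhds hzK] with w hw
      exact (h0 w hw).symm
    exact continuousAt_const.congr h

/-- **THE PARTITION FUNCTION** of the tiling of the ball by a level `Γ′`, from the cocompactness (K) and the proper
discontinuity (P) of the ball action (both in the shape of `LitCompactness`, read on the maps `ballActions`): a
function `χ : ℂ² → ℝ`, real-`C¹` on the ball and continuous, `≥ 0`, vanishing off a compact subset of the ball,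
LOCALLY FINITE on the orbits and with `Σ_φ χ (φ z) = 1` for every `z` in the ball. -/
theorem exists_partition (hΓ : IsCongruenceSubgroup c H Γ') (hτ : ∀ x, τ₀ (c x) = conj (τ₀ x))
    (hC : IsSylvester (H.map τ₀) C)
    (hcoc : ∃ K : Set (Fin 2 → ℂ), IsCompact K ∧ K ⊆ ball ∧ ∀ z ∈ ball, ∃ φ ∈ ballActions τ₀ C Γ', φ z ∈ K)
    (hpd : ∀ K : Set (Fin 2 → ℂ), IsCompact K → K ⊆ ball →
      {φ ∈ ballActions τ₀ C Γ' | ∃ z ∈ K, φ z ∈ K}.Finite) :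
    ∃ χ : (Fin 2 → ℂ) → ℝ, ContDiffOn ℝ 1 χ ball ∧ Continuous χ ∧ (∀ z, 0 ≤ χ z) ∧
      (∃ K₁ : Set (Fin 2 → ℂ), IsCompact K₁ ∧ K₁ ⊆ ball ∧ ∀ z ∉ K₁, χ z = 0) ∧
      (∀ z ∈ ball, HasSum (fun φ : ballActions τ₀ C Γ' => χ (φ.1 z)) 1) ∧
      (∀ z ∈ ball, ∃ U ∈ 𝓝 z, {φ : ballActions τ₀ C Γ' | ∃ w ∈ U, χ (φ.1 w) ≠ 0}.Finite) := by
  classical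
  obtain ⟨K, hK, hKb, hcov⟩ := hcoc
  obtain ⟨r, hr1, hKr⟩ := exists_nsq_lt_of_isCompact hK hKb
  obtain ⟨χ₀, hχ₀c, hχ₀0, hχ₀s⟩ := exists_bump r
  have hK₁c : IsCompact {z : Fin 2 → ℂ | nsq z ≤ r} := isCompact_nsq_le r
  have hK₁b : {z : Fin 2 → ℂ | nsq z ≤ r} ⊆ ball := nsq_le_subset_ball hr1
  have hχ₀K₁ : ∀ z ∉ {z : Fin 2 → ℂ | nsq z ≤ r}, χ₀ z = 0 := fun z hz => by
    by_contra h
    exact hz (le_of_lt ((hχ₀s z).1 h))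
  -- local finiteness of the family `χ₀ ∘ φ` around each point of the ball
  have hloc : ∀ z ∈ ball, ∃ ε > 0, Metric.closedBall z ε ⊆ ball ∧
      {φ : ballActions τ₀ C Γ' | ∃ w ∈ Metric.closedBall z ε, χ₀ (φ.1 w) ≠ 0}.Finite := by
    intro z hz
    obtain ⟨ε, hε, hεb⟩ := Metric.isOpen_iff.1 isOpen_ball z hz
    have hU : Metric.closedBall z (ε / 2) ⊆ ball := (Metric.closedBall_subset_ball (by linarith)).trans hεb
    refine ⟨ε / 2, by linarith, hU, ?_⟩
    have hfin := hpd (Metric.closedBall z (ε / 2) ∪ {z : Fin 2 → ℂ | nsq z ≤ r})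
      ((isCompact_closedBall z _).union hK₁c) (Set.union_subset hU hK₁b)
    refine (hfin.preimage (f := fun φ : ballActions τ₀ C Γ' => φ.1) Subtype.val_injective.injOn).subset ?_
    rintro φ ⟨w, hw, hne⟩
    exact ⟨φ.2, w, Or.inl hw, Or.inr (le_of_lt ((hχ₀s _).1 hne))⟩
  have hfin : ∀ z ∈ ball, ∃ s : Finset (ballActions τ₀ C Γ'), ∀ φ ∉ s, χ₀ (φ.1 z) = 0 := by
    intro z hz
    obtain ⟨ε, hε, -, hfinU⟩ := hloc z hz
    refine ⟨hfinU.toFinset, fun φ hφ => ?_⟩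
    by_contra h
    exact hφ (hfinU.mem_toFinset.mpr ⟨z, Metric.mem_closedBall_self hε.le, h⟩)
  -- `S z = Σ_φ χ₀ (φ z)`
  have hsum : ∀ z ∈ ball, HasSum (fun φ : ballActions τ₀ C Γ' => χ₀ (φ.1 z))
      (∑' φ : ballActions τ₀ C Γ', χ₀ (φ.1 z)) := by
    intro z hz
    obtain ⟨s, hs⟩ := hfin z hz
    exact (summable_of_ne_finset_zero hs).hasSum
  have hSpos : ∀ z ∈ ball, 0 < ∑' φ : ballActions τ₀ C Γ', χ₀ (φ.1 z) := by
    intro z hz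
    obtain ⟨φ₀, hφ₀, hφ₀K⟩ := hcov z hz
    have h1 : 0 < χ₀ (φ₀ z) := lt_of_le_of_ne (hχ₀0 _) (Ne.symm ((hχ₀s _).2 (hKr _ hφ₀K)))
    have h2 : χ₀ ((⟨φ₀, hφ₀⟩ : ballActions τ₀ C Γ').1 z) ≤ ∑' φ : ballActions τ₀ C Γ', χ₀ (φ.1 z) :=
      (hsum z hz).summable.le_tsum _ fun φ _ => hχ₀0 _
    exact lt_of_lt_of_le h1 h2
  have hSinv : ∀ φ' : ballActions τ₀ C Γ', ∀ z ∈ ball,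
      ∑' φ : ballActions τ₀ C Γ', χ₀ (φ.1 (φ'.1 z)) = ∑' φ : ballActions τ₀ C Γ', χ₀ (φ.1 z) := by
    intro φ' z hz
    obtain ⟨e, he⟩ := exists_rtrans_equiv hΓ hτ hC φ'
    rw [← Equiv.tsum_eq e (fun θ : ballActions τ₀ C Γ' => χ₀ (θ.1 z))]
    exact tsum_congr fun φ => by rw [he φ z hz]
  -- `χ = χ₀ / S`
  have hχc : ContDiffOn ℝ 1 (fun z => χ₀ z / ∑' φ : ballActions τ₀ C Γ', χ₀ (φ.1 z)) ball := by
    refine contDiffOn_of_locally_contDiffOn fun z hz => ?_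
    obtain ⟨ε, hε, hεb, hfinU⟩ := hloc z hz
    refine ⟨Metric.ball z ε, Metric.isOpen_ball, Metric.mem_ball_self hε, ?_⟩
    have hSeq : ∀ w ∈ ball ∩ Metric.ball z ε,
        ∑' φ : ballActions τ₀ C Γ', χ₀ (φ.1 w) = ∑ φ ∈ hfinU.toFinset, χ₀ (φ.1 w) := by
      intro w hw
      exact tsum_eq_sum fun φ hφ => by
        by_contra h
        exact hφ (hfinU.mem_toFinset.mpr ⟨w, Metric.ball_subset_closedBall hw.2, h⟩)
    have hSc : ContDiffOn ℝ 1 (fun w => ∑' φ : ballActions τ₀ C Γ', χ₀ (φ.1 w)) (ball ∩ Metric.ball z ε) := by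
      refine (ContDiffOn.sum (s := hfinU.toFinset) (fun φ _ => ?_)).congr fun w hw => hSeq w hw
      exact (hχ₀c.comp_contDiffOn (contDiffOn_of_mem_ballActions hΓ hτ hC φ.2)).mono Set.inter_subset_left
    exact (hχ₀c.contDiffOn.mono Set.inter_subset_left).div hSc fun w hw => (hSpos w hw.1).ne'
  refine ⟨fun z => χ₀ z / ∑' φ : ballActions τ₀ C Γ', χ₀ (φ.1 z), hχc, ?_, ?_,
    ⟨{z : Fin 2 → ℂ | nsq z ≤ r}, hK₁c, hK₁b, fun z hz => by simp [hχ₀K₁ z hz]⟩, ?_, ?_⟩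
  · exact continuous_of_continuousOn_of_eqOn_zero_real isOpen_ball hK₁c.isClosed hK₁b hχc.continuousOn
      fun z hz => by simp [hχ₀K₁ z hz]
  · intro z
    exact div_nonneg (hχ₀0 z) (tsum_nonneg fun φ => hχ₀0 _)
  · intro z hz
    have h := (hsum z hz).div_const (∑' φ : ballActions τ₀ C Γ', χ₀ (φ.1 z))
    rw [div_self (hSpos z hz).ne'] at h
    refine h.congr_fun fun φ => ?_
    simp only
    rw [hSinv φ z hz]
  · intro z hz
    obtain ⟨ε, hε, -, hfinU⟩ := hloc z hz
    refine ⟨Metric.closedBall z ε, Metric.closedBall_mem_nhds z hε, hfinU.subset ?_⟩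
    rintro φ ⟨w, hw, hne⟩
    refine ⟨w, hw, fun h => hne ?_⟩
    simp [h]

end Partition

end Summit.Ventures.HodgeRepro.Tier4.Line4

end
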